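import Mathlib
import Literature.AlgebraicGeometry.Resolution.CobordantGame
import Literature.AlgebraicGeometry.Resolution.CobordantArcLemma
import Literature.AlgebraicGeometry.Resolution.CobordantChartOneMove

/-!
# The local weighted resolution game: winning values are NOT restriction-monotone

Folklore, proved (second line lead of crux `LocalWeightedDrop`, stmt-ResolutionOfSingularities-8899,
route ResolutionOfSingularities/WeightedInvariant; the planner's finding "F1" for the line
`cone-game-restriction-rank`).

Włodarczyk's cobordant drop principle (arXiv:2203.03090 Thm 4.3.1) is stated for local invariants
satisfying a RESTRICTION axiom `Inv_p(I|_Y) ≥ Inv_p(I)` for regular subschemes `Y`; applied on the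
full cobordant blow-up `B = 𝔸ⁿ⁺¹` with `Y = {s = 0}` the exceptional divisor it reduces the drop at an
honest `(n+1)`-variable `s`-saturated successor `g(s,y)` to a drop at its restriction `g(0,y)`, the
translate of the weighted tangent cone.  This file records that the GAME VALUES of the local weighted
resolution game (`CobordantGame.WonBy`, `CobordantGame.leastRank`) do not enjoy this axiom, even between
germs of the same order: with `s = X 0`,

* `g = y₁² + y₂³ s²` (the germ `x² + y³z²` of `CobordantArcLemma` with the exceptional variable in the
  `z`-slot) is singular, `s ∤ g`, `ord g = ord g(0,·) = 2`, and NO legal move wins from `g` in one step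
  (`not_wonBy_zero_rotatedWitness`, transported from `CobordantArc.witness_has_singular_successor`
  through the cyclic renaming of the variables), while
* its restriction `g(0,·) = y₁²` (as a germ in the two variables `y₁, y₂`) is won in one move by the
  divisorial move `w = (1,0)` (`wonBy_zero_X_sq`: every successor `(c + y₁)²` is a unit);
* hence `not_restrictionMonotone_wonBy`: it is NOT true that `WonBy α n g(0,·) → WonBy α (n+1) g` for
  singular `g` with `s ∤ g` and `ord g = ord g(0,·)` — a restriction-monotone rank with the crux's drop
  property, if one exists in characteristic `p`, is not the least game value.

Also: `wonBy_zero_iff` (value `0` = some legal move has no singular successor).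
-/

namespace Literature.AlgebraicGeometry.Resolution.CobordantGame

open MvPowerSeries

variable {k : Type} [Field k]

/-- Game value `0` means: some legal move has no singular successor at all (a one-move win). [folklore] -/
theorem wonBy_zero_iff {n : ℕ} (f : MvPowerSeries (Fin n) k) :
    WonBy k 0 n f ↔ ∃ (θ : Fin n → MvPowerSeries (Fin n) k) (w : Fin n → ℕ), IsMove k θ w ∧
      ∀ g, ¬ IsSuccessor k f θ w g := by
  rw [wonBy_iff]
  constructor
  · rintro ⟨θ, w, hm, h⟩
    refine ⟨θ, w, hm, fun g hg => ?_⟩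
    obtain ⟨β, hβ, -⟩ := h g hg
    exact not_lt_bot hβ
  · rintro ⟨θ, w, hm, h⟩
    exact ⟨θ, w, hm, fun g hg => (h g hg).elim⟩

/-! ### The rotated witness `y₁² + y₂³ s²` is not won in one move -/

/-- The cyclic renaming `x ↦ X 1, y ↦ X 2, z ↦ X 0` carries the witness `x² + y³z²` of
`CobordantArcLemma` to `X 1 ^ 2 + X 2 ^ 3 * X 0 ^ 2`. [folklore] -/
theorem subst_rotate_witness :
    MvPowerSeries.subst (fun i : Fin 3 => (MvPowerSeries.X (finRotate 3 i) : MvPowerSeries (Fin 3) k))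
      (CobordantArc.witness k) =
    MvPowerSeries.X 1 ^ 2 + MvPowerSeries.X 2 ^ 3 * MvPowerSeries.X 0 ^ 2 := by
  have ha : MvPowerSeries.HasSubst
      (fun i : Fin 3 => (MvPowerSeries.X (finRotate 3 i) : MvPowerSeries (Fin 3) k)) :=
    MvPowerSeries.hasSubst_of_constantCoeff_zero fun i => MvPowerSeries.constantCoeff_X _
  rw [CobordantArc.witness, ← MvPowerSeries.coe_substAlgHom ha, map_add, map_mul, map_pow, map_pow, map_pow,
    MvPowerSeries.coe_substAlgHom ha, MvPowerSeries.subst_X ha, MvPowerSeries.subst_X ha,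
    MvPowerSeries.subst_X ha]
  rfl

/-- From the rotated witness `y₁² + y₂³ s²` EVERY legal move has an off-vertex exceptional point whose
`s`-saturated successor is singular (transport of `CobordantArc.witness_has_singular_successor` along the
cyclic renaming, which composes with the coordinate change of the move). [folklore] -/
theorem rotatedWitness_has_singular_successor (θ : Fin 3 → MvPowerSeries (Fin 3) k) (w : Fin 3 → ℕ)
    (hθ0 : ∀ i, MvPowerSeries.constantCoeff (θ i) = 0)
    (hdet : IsUnit (Matrix.det (Matrix.of fun i j => MvPowerSeries.coeff (Finsupp.single j 1) (θ i))))
    (hw : ∃ i, 0 < w i) :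
    ∃ (c : Fin 3 → k), (∃ i, 0 < w i ∧ c i ≠ 0) ∧ ∃ (a : ℕ) (g : MvPowerSeries (Fin 4) k),
      MvPowerSeries.subst (cruxChart k w c) (MvPowerSeries.subst θ
        (MvPowerSeries.X 1 ^ 2 + MvPowerSeries.X 2 ^ 3 * MvPowerSeries.X 0 ^ 2 : MvPowerSeries (Fin 3) k)) =
        MvPowerSeries.X 0 ^ a * g ∧
      ¬ MvPowerSeries.X 0 ∣ g ∧
      (MvPowerSeries.constantCoeff g = 0 ∧ ∀ j, MvPowerSeries.coeff (Finsupp.single j 1) g = 0) := by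
  have ha : MvPowerSeries.HasSubst
      (fun i : Fin 3 => (MvPowerSeries.X (finRotate 3 i) : MvPowerSeries (Fin 3) k)) :=
    MvPowerSeries.hasSubst_of_constantCoeff_zero fun i => MvPowerSeries.constantCoeff_X _
  have hθ : MvPowerSeries.HasSubst θ := MvPowerSeries.hasSubst_of_constantCoeff_zero hθ0
  -- the move seen from the un-rotated witness
  set θ' : Fin 3 → MvPowerSeries (Fin 3) k := fun i => θ (finRotate 3 i) with hθ'def
  have hθ'0 : ∀ i, MvPowerSeries.constantCoeff (θ' i) = 0 := fun i => hθ0 _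
  have hdet' : IsUnit (Matrix.det (Matrix.of fun i j => MvPowerSeries.coeff (Finsupp.single j 1) (θ' i))) := by
    have hsub : (Matrix.of fun i j => MvPowerSeries.coeff (Finsupp.single j 1) (θ' i)) =
        (Matrix.of fun i j => MvPowerSeries.coeff (Finsupp.single j 1) (θ i)).submatrix (finRotate 3) id := by
      ext i j
      simp [hθ'def]
    rw [hsub, Matrix.det_permute]
    exact (Units.isUnit _).map (Int.castRingHom k) |>.mul hdet
  have hcomp : MvPowerSeries.subst θ
      (MvPowerSeries.X 1 ^ 2 + MvPowerSeries.X 2 ^ 3 * MvPowerSeries.X 0 ^ 2 : MvPowerSeries (Fin 3) k) =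
      MvPowerSeries.subst θ' (CobordantArc.witness k) := by
    rw [← subst_rotate_witness, MvPowerSeries.subst_comp_subst_apply ha hθ]
    congr 1
    funext i
    rw [MvPowerSeries.subst_X hθ]
  obtain ⟨c, hoff, a, g, hfac, hndvd, hsing⟩ := CobordantArc.witness_has_singular_successor k θ' w hθ'0 hdet' hw
  refine ⟨c, hoff, a, g, ?_, hndvd, hsing⟩
  rw [hcomp]
  exact hfac

/-- Hence the rotated witness is NOT won in one move: its game value is not `0`. [folklore] -/
theorem not_wonBy_zero_rotatedWitness :
    ¬ WonBy k 0 3 (MvPowerSeries.X 1 ^ 2 + MvPowerSeries.X 2 ^ 3 * MvPowerSeries.X 0 ^ 2 :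
      MvPowerSeries (Fin 3) k) := by
  rw [wonBy_zero_iff]
  rintro ⟨θ, w, ⟨hθ0, hdet, hw⟩, hnone⟩
  obtain ⟨c, hc, a, g, hfac, hndvd, hsing⟩ := rotatedWitness_has_singular_successor θ w hθ0 hdet hw
  exact hnone g ⟨c, a, hc, hfac, hndvd, hsing⟩

/-! ### Its restriction `y₁²` is won in one move -/

/-- The `s⁰`-slice of the rotated witness is `y₁²`, i.e. `X 0 ^ 2` in the two variables `(y₁, y₂)`. [folklore] -/
theorem slice_rotatedWitness :
    (show MvPowerSeries (Fin 2) k from fun β => MvPowerSeries.coeff (Finsupp.cons 0 β)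
      (MvPowerSeries.X 1 ^ 2 + MvPowerSeries.X 2 ^ 3 * MvPowerSeries.X 0 ^ 2 : MvPowerSeries (Fin 3) k)) =
    MvPowerSeries.X 0 ^ 2 := by
  classical
  ext β
  show MvPowerSeries.coeff (Finsupp.cons 0 β)
      (MvPowerSeries.X 1 ^ 2 + MvPowerSeries.X 2 ^ 3 * MvPowerSeries.X 0 ^ 2 : MvPowerSeries (Fin 3) k) = _
  rw [map_add, MvPowerSeries.X_pow_eq, MvPowerSeries.X_pow_eq, MvPowerSeries.X_pow_eq,
    MvPowerSeries.monomial_mul_monomial, MvPowerSeries.coeff_monomial, MvPowerSeries.coeff_monomial,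
    one_mul, MvPowerSeries.coeff_X_pow]
  have h1 : (Finsupp.cons 0 β = Finsupp.single (1 : Fin 3) 2) ↔ β = Finsupp.single 0 2 := by
    rw [show (1 : Fin 3) = (0 : Fin 2).succ from rfl, Finsupp.cons_eq_single_succ_iff]
    simp
  have h2 : Finsupp.cons 0 β ≠ Finsupp.single (2 : Fin 3) 3 + Finsupp.single 0 2 := by
    intro h
    have := DFunLike.congr_fun h 0
    simp at this
  rw [if_neg h2, add_zero]
  by_cases hβ : β = Finsupp.single 0 2
  · rw [if_pos (h1.mpr hβ), if_pos hβ]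
  · rw [if_neg (fun h => hβ (h1.mp h)), if_neg hβ]

/-- `y₁²`, as a germ in the two variables `(y₁, y₂)`, is won in ONE move: after the divisorial move
`θ = X`, `w = (1, 0)` every `s`-saturated successor is the unit `(c + y₁)²` (the chart point has `c ≠ 0`
in the only positive-weight slot), so none is singular. [folklore] -/
theorem wonBy_zero_X_sq : WonBy k 0 2 (MvPowerSeries.X 0 ^ 2 : MvPowerSeries (Fin 2) k) := by
  classical
  rw [wonBy_zero_iff]
  set w : Fin 2 → ℕ := fun i => if i = 0 then 1 else 0 with hwdef
  refine ⟨MvPowerSeries.X, w, ⟨fun i => MvPowerSeries.constantCoeff_X i, ?_, ⟨0, by simp [hwdef]⟩⟩, ?_⟩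
  · have h1 : (Matrix.of fun i j : Fin 2 =>
        MvPowerSeries.coeff (Finsupp.single j 1) (MvPowerSeries.X i : MvPowerSeries (Fin 2) k)) = 1 := by
      ext i j
      rw [Matrix.of_apply, MvPowerSeries.coeff_X, Matrix.one_apply]
      by_cases h : i = j
      · subst h; simp
      · rw [if_neg, if_neg h]
        intro h'
        exact h ((Finsupp.single_left_injective Nat.one_ne_zero) h').symm
    rw [h1, Matrix.det_one]
    exact isUnit_one
  · rintro g ⟨c, e, ⟨i, hwi, hci⟩, hfac, hndvd, hsing⟩
    -- the polynomial germ `X 0 ^ 2`, weighted homogeneous of `w`-degree 2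
    set P : MvPolynomial (Fin 2) k := MvPolynomial.X 0 ^ 2 with hPdef
    have hPcoe : (MvPowerSeries.X 0 ^ 2 : MvPowerSeries (Fin 2) k) = (P : MvPowerSeries (Fin 2) k) := by
      simp [hPdef, MvPolynomial.coe_pow, MvPolynomial.coe_X]
    have hP : P.IsWeightedHomogeneous w 2 := by
      have := (MvPolynomial.isWeightedHomogeneous_X k w (0 : Fin 2)).pow 2
      simpa [hwdef] using this
    have hP0 : P ≠ 0 := pow_ne_zero 2 (MvPolynomial.X_ne_zero 0)
    have hP0' : (P : MvPowerSeries (Fin 2) k) ≠ 0 := by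
      intro h; apply hP0; exact MvPolynomial.coe_eq_zero_iff.mp h
    -- the literal crux chart is `chart w c'` at the convention point
    set c' : Fin 2 → k := fun i => if 0 < w i then c i else 0 with hc'def
    have hc' : ∀ i, w i = 0 → c' i = 0 := fun i hi => by simp [hc'def, hi]
    have hcc : cruxChart k w c = CobordantChart.chart w c' := CobordantChart.cruxChart_eq_chart w c
    rw [hcc, MvPowerSeries.subst_self, id, hPcoe] at hfac
    have he : e = 2 := by
      have h1 := CobordantChart.eq_weightedOrder_of_factor w c' hc' hP0' hfac hndvd
      rw [CobordantChart.weightedOrder_coe_of_isWeightedHomogeneous w hP hP0] at h1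
      exact_mod_cast h1
    subst he
    obtain ⟨hPa, -, -⟩ := (CobordantChart.successor_singular_iff w c' hc' _ hfac).mp hsing
    rw [CobordantChart.initEval_coe, hP.weightedHomogeneousComponent_same] at hPa
    have hi0 : i = 0 := by
      by_contra h
      simp [hwdef, h] at hwi
    subst hi0
    have : c' 0 = c 0 := by simp [hc'def, hwdef]
    apply hci
    have hev : MvPolynomial.eval c' P = c 0 ^ 2 := by simp [hPdef, this]
    rw [hev] at hPa
    exact pow_eq_zero_iff (n := 2) (by norm_num) |>.mp hPa

/-! ### The failure of restriction-monotonicity -/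

/-- The rotated witness is a singular germ. [folklore] -/
theorem isSingular_rotatedWitness :
    IsSingular k (MvPowerSeries.X 1 ^ 2 + MvPowerSeries.X 2 ^ 3 * MvPowerSeries.X 0 ^ 2 :
      MvPowerSeries (Fin 3) k) := by
  classical
  have hcoeff : ∀ d : Fin 3 →₀ ℕ, MvPowerSeries.coeff d
      (MvPowerSeries.X 1 ^ 2 + MvPowerSeries.X 2 ^ 3 * MvPowerSeries.X 0 ^ 2 : MvPowerSeries (Fin 3) k) =
      (if d = Finsupp.single 1 2 then 1 else 0) +
        (if d = Finsupp.single 2 3 + Finsupp.single 0 2 then 1 else 0) := by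
    intro d
    rw [map_add, MvPowerSeries.X_pow_eq, MvPowerSeries.X_pow_eq, MvPowerSeries.X_pow_eq,
      MvPowerSeries.monomial_mul_monomial, MvPowerSeries.coeff_monomial, MvPowerSeries.coeff_monomial,
      one_mul]
  refine ⟨?_, ?_, fun i => ?_⟩
  · intro h
    have := hcoeff (Finsupp.single 1 2)
    rw [h, map_zero, if_pos rfl, if_neg] at this
    · norm_num at this
    · intro h'
      have := DFunLike.congr_fun h' 1
      simp at this
  · rw [← MvPowerSeries.coeff_zero_eq_constantCoeff_apply, hcoeff, if_neg, if_neg, add_zero]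
    · intro h'
      have := DFunLike.congr_fun h' 0
      simp at this
    · intro h'
      have := DFunLike.congr_fun h' 1
      simp at this
  · rw [hcoeff, if_neg, if_neg, add_zero]
    · intro h'
      have := DFunLike.congr_fun h' 0
      simp [Finsupp.single_apply] at this
      fin_cases i <;> simp at this
    · intro h'
      have := DFunLike.congr_fun h' 1
      simp [Finsupp.single_apply] at this
      fin_cases i <;> simp at this

/-- `s ∤` the rotated witness (`s = X 0`): its monomial `y₁²` has no `s`. [folklore] -/
theorem not_X_dvd_rotatedWitness :
    ¬ (MvPowerSeries.X (0 : Fin 3) ∣ (MvPowerSeries.X 1 ^ 2 + MvPowerSeries.X 2 ^ 3 * MvPowerSeries.X 0 ^ 2 :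
      MvPowerSeries (Fin 3) k)) := by
  classical
  rw [MvPowerSeries.X_dvd_iff]
  intro h
  have h1 := h (Finsupp.single 1 2) (by simp)
  rw [map_add, MvPowerSeries.X_pow_eq, MvPowerSeries.X_pow_eq, MvPowerSeries.X_pow_eq,
    MvPowerSeries.monomial_mul_monomial, MvPowerSeries.coeff_monomial, MvPowerSeries.coeff_monomial,
    one_mul, if_pos rfl, if_neg] at h1
  · norm_num at h1
  · intro h'
    have := DFunLike.congr_fun h' 1
    simp at this

/-- The rotated witness has order `2`. [folklore] -/
theorem order_rotatedWitness :
    (MvPowerSeries.X 1 ^ 2 + MvPowerSeries.X 2 ^ 3 * MvPowerSeries.X 0 ^ 2 : MvPowerSeries (Fin 3) k).order = 2 := by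
  classical
  apply le_antisymm
  · have h := MvPowerSeries.order_le (f := (MvPowerSeries.X 1 ^ 2 + MvPowerSeries.X 2 ^ 3 * MvPowerSeries.X 0 ^ 2 :
        MvPowerSeries (Fin 3) k)) (d := Finsupp.single 1 2) ?_
    · simpa [Finsupp.degree_single] using h
    · rw [map_add, MvPowerSeries.X_pow_eq, MvPowerSeries.X_pow_eq, MvPowerSeries.X_pow_eq,
        MvPowerSeries.monomial_mul_monomial, MvPowerSeries.coeff_monomial, MvPowerSeries.coeff_monomial,
        one_mul, if_pos rfl, if_neg]
      · norm_num
      · intro h'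
        have := DFunLike.congr_fun h' 1
        simp at this
  · exact (FormalCoordChange.two_le_order_iff _).mpr ⟨isSingular_rotatedWitness.2.1, isSingular_rotatedWitness.2.2⟩

/-- `y₁²` has order `2` (two variables). [folklore] -/
theorem order_X_sq : (MvPowerSeries.X 0 ^ 2 : MvPowerSeries (Fin 2) k).order = 2 := by
  classical
  rw [MvPowerSeries.X_pow_eq, MvPowerSeries.order_monomial, if_neg one_ne_zero]
  simp [Finsupp.degree_single]

/-- RESTRICTION-MONOTONICITY FAILS FOR GAME VALUES.  It is not true that a winning value of the
restriction `g(0,·)` of a singular germ `g ∈ k[[s,y]]` with `s ∤ g` and `ord g = ord g(0,·)` is a winning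
value of `g`: the rotated witness `y₁² + y₂³s²` has `g(0,·) = y₁²` of value `0` but is not itself of value
`0`.  (So Włodarczyk's (Restriction) axiom, arXiv:2203.03090 §4.3, fails for the least game rank of the
local weighted resolution game.) [folklore] -/
theorem not_restrictionMonotone_wonBy :
    ¬ ∀ (n : ℕ) (g : MvPowerSeries (Fin (n + 1)) k) (α : Ordinal.{0}), IsSingular k g →
      ¬ (MvPowerSeries.X (0 : Fin (n + 1)) ∣ g) →
      g.order = MvPowerSeries.order
        (show MvPowerSeries (Fin n) k from fun β => MvPowerSeries.coeff (Finsupp.cons 0 β) g) →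
      WonBy k α n (show MvPowerSeries (Fin n) k from fun β => MvPowerSeries.coeff (Finsupp.cons 0 β) g) →
      WonBy k α (n + 1) g := by
  intro h
  have h2 := h 2 (MvPowerSeries.X 1 ^ 2 + MvPowerSeries.X 2 ^ 3 * MvPowerSeries.X 0 ^ 2) 0
    isSingular_rotatedWitness not_X_dvd_rotatedWitness
  rw [slice_rotatedWitness, order_rotatedWitness, order_X_sq] at h2
  exact not_wonBy_zero_rotatedWitness (h2 rfl wonBy_zero_X_sq)

end Literature.AlgebraicGeometry.Resolution.CobordantGame
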